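import Literature.NumberTheory.EllipticCurves.CharIdealDualInfResFrameProofs
import Literature.NumberTheory.GaloisRepresentations.HOneUnramifiedFiniteKernelProofs
import Literature.NumberTheory.GaloisRepresentations.ConjugationDescent
import Literature.NumberTheory.EllipticCurves.AnticyclotomicBigGaloisRep
import HarnessLib

/-!
# The local term of the big representation at a finitely decomposed place — the GENERAL FRAME:
# two inputs on the shifted endomorphism (`M^N/(ψ−1)` finite; the dual of `H¹(N, M)^ψ` is f.g. torsion
# with `P ∈ Ch`) ⟹ `H¹(G, M)^∨` is f.g. torsion with `P ∈ Ch_Λ`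

Topic `NumberTheory/EllipticCurves`; namespace `Literature.NumberTheory.EllipticCurves.BigGaloisRep`.
THEOREMS ONLY (no definition, no named fact, no `sorry`). Cell `bsd-stepL`, K2 support 20495
`JSWSigmaLocalCharIdeal`, module L5 (`HOME/imc-p1/g13/L5-PLAN`); seat `bsd-stepL-imc-p1` g13.

**`moduleFinite_isTorsion_mem_charIdeal_dual_h1_bigRep_of_shift_data`**: for `M = bigRep κ ρ` (any
discrete `𝒪 = ℤ_p`-representation `A` of a topological group `G`), `N ⊴ G`, `ψ ∈ G` with `N·⟨ψ⟩` dense,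
IF (S2) `M^N/(ψ − 1)M^N` is finite and (S3) the `Λ`-submodule `L' = {y ∈ H¹(N, M) | ψ·y = y}`
(`= ker(conjMap ψ − 1)`, which contains every restriction by `conjMap_resSubgroup_one`) has finitely
generated torsion Pontryagin dual with `P ∈ Ch_Λ((L')^∨)`, THEN `H¹(G, M)^∨` is finitely generated and
torsion over `Λ` with `P ∈ Ch_Λ(H¹(G, M)^∨)`. Both inputs are statements about the SHIFTED ENDOMORPHISM
`Φ ↦ ρ(ψ)(Φ(· − κψ))` by the model isomorphisms of `BigRepShiftedEndomorphismModelsProofs`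
(`M^N ≅ C^∞(ℤ_p, A^N)`, `H¹(N, M) ≅ C^∞(ℤ_p, H¹(N, A))`), where the typer lane's Mahler-coordinate
algebra (`BigRepModuleDualShiftedEndomorphism*`: `Ch((ker E)^∨) = (det((1+T)^c ᵗM − 1))`) computes them;
the finite case is `moduleFinite_isTorsion_charIdeal_eq_top_dual_h1_bigRep_of_finite`.

References: [GreenbergVatsal2000] Prop. 2.4; [Skinner2016PacificMC] §2.3; [SerreLocalFields1979] XIII §1, VII §5.
-/

noncomputable section

open scoped Classical Pointwise

open CategoryTheory

universe u

namespace Literature.NumberTheory.EllipticCurves.BigGaloisRep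

open Literature.NumberTheory.GaloisRepresentations BigRepModule _root_.Subgroup

variable {p : ℕ} [Fact p.Prime] {A : Type u} [AddCommGroup A] [Module ℤ_[p] A]
  [TopologicalSpace A] [DiscreteTopology A]
  {G : Type u} [Group G] [TopologicalSpace G] [IsTopologicalGroup G]
  [TopologicalSpace (PowerSeries ℤ_[p])] [ContinuousSMul (PowerSeries ℤ_[p]) (BigRepModule ℤ_[p] p A)]
  (κ : G →ₜ* Multiplicative ℤ_[p]) (ρ : ContinuousRep G ℤ_[p] A) (N : Subgroup G) [N.Normal]

/-- `(ψ − 1)` preserves `M^N`. [cite: SerreGaloisCohomology1997, I §2.6 (the `G/H`-module `A^H`)] -/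
theorem shift_sub_mem_invariantsOf_bigRep (ψ : G) (Φ : BigRepModule ℤ_[p] p A)
    (hΦ : Φ ∈ (bigRep κ ρ).invariantsOf N) :
    (((bigRep κ ρ).toTopRep.ρ ψ).toLinearMap - LinearMap.id :
      (BigRepModule ℤ_[p] p A) →ₗ[PowerSeries ℤ_[p]] BigRepModule ℤ_[p] p A) Φ ∈ (bigRep κ ρ).invariantsOf N := by
  rw [ContinuousRep.mem_invariantsOf_iff] at hΦ ⊢
  intro n
  change bigRep κ ρ (n : G) (bigRep κ ρ ψ Φ - Φ) = bigRep κ ρ ψ Φ - Φ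
  have hn' : ψ⁻¹ * (n : G) * ψ ∈ N := Subgroup.Normal.conj_mem' inferInstance (n : G) n.2 ψ
  have h2 : bigRep κ ρ (ψ⁻¹ * (n : G) * ψ) Φ = Φ := hΦ ⟨_, hn'⟩
  have h1 : bigRep κ ρ (n : G) (bigRep κ ρ ψ Φ) = bigRep κ ρ ψ Φ := by
    have e : (n : G) * ψ = ψ * (ψ⁻¹ * (n : G) * ψ) := by group
    rw [← Module.End.mul_apply, ← map_mul, e, map_mul, Module.End.mul_apply, h2]
  rw [map_sub, h1, hΦ n]

/-- **The general frame of the finitely decomposed local term.** For `M = bigRep κ ρ`, `N ⊴ G`, `ψ` with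
`N·⟨ψ⟩` dense: if `M^N/(ψ − 1)M^N` is finite (S2) and the `ψ`-fixed classes `L' = ker(conjMap ψ − 1)`
of `H¹(N, M)` have finitely generated torsion dual with `P ∈ Ch_Λ((L')^∨)` (S3), then `H¹(G, M)^∨` is
finitely generated torsion with `P ∈ Ch_Λ(H¹(G, M)^∨)`.
[cite: GreenbergVatsal2000, Prop. 2.4] [cite: Skinner2016PacificMC, §2.3 (p. 180)] [cite: SerreLocalFields1979, XIII §1] -/
theorem moduleFinite_isTorsion_mem_charIdeal_dual_h1_bigRep_of_shift_data {ψ : G}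
    (hdense : Dense ((N : Set G) * (zpowers ψ : Set G)))
    [Finite ((bigRep κ ρ).invariantsOf N ⧸ LinearMap.range
      ((((bigRep κ ρ).toTopRep.ρ ψ).toLinearMap - LinearMap.id :
        (BigRepModule ℤ_[p] p A) →ₗ[PowerSeries ℤ_[p]] BigRepModule ℤ_[p] p A).restrict
        (shift_sub_mem_invariantsOf_bigRep κ ρ N ψ)))]
    [Module.Finite (IwasawaAlgebra p) (CharacterModule (LinearMap.ker
      ((conjMap (bigRep κ ρ).toTopRep N ψ 1).hom.toLinearMap - LinearMap.id)))]
    (htors : Module.IsTorsion (IwasawaAlgebra p) (CharacterModule (LinearMap.ker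
      ((conjMap (bigRep κ ρ).toTopRep N ψ 1).hom.toLinearMap - LinearMap.id))))
    {P : IwasawaAlgebra p}
    (hP : P ∈ Module.charIdeal (IwasawaAlgebra p) (CharacterModule (LinearMap.ker
      ((conjMap (bigRep κ ρ).toTopRep N ψ 1).hom.toLinearMap - LinearMap.id)))) :
    Module.Finite (IwasawaAlgebra p) (CharacterModule (continuousCohomology 1 (bigRep κ ρ).toTopRep)) ∧
      Module.IsTorsion (IwasawaAlgebra p) (CharacterModule (continuousCohomology 1 (bigRep κ ρ).toTopRep)) ∧
      P ∈ Module.charIdeal (IwasawaAlgebra p) (CharacterModule (continuousCohomology 1 (bigRep κ ρ).toTopRep)) := by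
  set X := (bigRep κ ρ).toTopRep with hX
  -- (S2) ⟹ the unramified classes are finite
  have hker : Set.Finite {c : continuousCohomology 1 X | resSubgroup X N 1 c = 0} :=
    finite_setOf_resSubgroup_eq_zero_of_finite_coinvariants X (bigRep κ ρ).continuous_smul hdense
      ((bigRep κ ρ).invariantsOf N) (fun _ => Iff.rfl) (shift_sub_mem_invariantsOf_bigRep κ ρ N ψ)
  -- (S3) ⟹ the frame, with `L'` the `ψ`-fixed classes
  have hL' : ∀ y, (resSubgroup X N 1).hom y ∈ LinearMap.ker
      ((conjMap X N ψ 1).hom.toLinearMap - LinearMap.id) := fun y => by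
    rw [LinearMap.mem_ker, LinearMap.sub_apply, LinearMap.id_apply, sub_eq_zero]
    exact conjMap_resSubgroup_one X N ψ y
  exact moduleFinite_isTorsion_mem_charIdeal_dual_h1_of_finite_ker_res N (bigRep κ ρ) hker _ hL' htors hP

end Literature.NumberTheory.EllipticCurves.BigGaloisRep

end
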